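import Summits.CriticalPhenomena.PercolationContinuityZ3.Theorems.Transplant.Slab111HubXLegs
import HarnessLib

/-!
# The HUB ROUTING of the `(111)`-films, III-X (exact ride windows): routing 1 (`P₁ = leg₁ · F₁[e₁ → d] · H_D · F₂ · leg₂`, branch `H_A · F₃ · leg₃`)

builds on p205010 (kernel theorem, internal audit signed; external expert review pending) — NOT used in this file.  Lane `prim-bschramm`, seat
`prim-bschramm-p2` (gen 37; class C1b; memo `HOME/bschramm/P2-LATTICES.md` §135); helper file (`--supports stmt-CriticalPhenomena-4575 --as helper`).
From a `HubDataX` («Slab111HubXData», «Slab111HubXLegs») the FIRST routing of the swap pair: the rerouted path runs along the leg of `E₁`, the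
`F₁`-helix from `e₁` through `c, y` to `d`, the hub `H_D`, the `F₂`-helix to `e₂` and the leg of `E₂`; the attachment vertex is `c` with successor
`y`; the branch is `H_A`, the `F₃`-helix to `e₃`, the leg of `w'`.  **`HubDataX.route₁`**: a `VRouteData (film k) PR W E₁ E₂ w'` with `y = X.y` and
`b = H_A`. [cite: DuminilCopinSidoraviciusTassion2016, §2.3 (proof of Fact 2: the three disjoint paths γ_u, γ_v, γ_w in B_R(z))]
-/

noncomputable section

namespace Summit.CriticalPhenomena.PercolationContinuityZ3.Theorems.Transplant

open Literature.Probability.Percolation Literature.Probability.LatticeModels SimpleGraph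
open scoped Classical

namespace Slab111

namespace HubDataX

variable {k : ℕ} {z : Site 2} {c0 : ℤ} {W PR : Set (slab111 k)} {E₁ E₂ w' : slab111 k} (X : HubDataX k z c0 W PR E₁ E₂ w')

/-- The rerouted path of routing 1. [folklore] -/
def SP1 : List (slab111 k) := (X.leg₁ ++ X.S1.tail) ++ ((X.d :: X.HD :: X.S2 X.LD) ++ X.leg₂.tail).tail

/-- The branch of routing 1. [folklore] -/
def Br1 : List (slab111 k) := X.HA :: (X.S3 X.LA ++ X.leg₃.tail)

/-- `SP1` is a self-avoiding path `E₁ → E₂`. [folklore] -/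
theorem gSP1 : GPath (film k) X.SP1 E₁ E₂ := by
  have gT : GPath (film k) ((X.d :: X.HD :: X.S2 X.LD) ++ X.leg₂.tail) X.d E₂ :=
    X.gT1.trans X.hl2 fun v hv2 hvT => by
      rcases List.mem_cons.1 hvT with h | h
      · exact absurd (h ▸ X.cdy_S1.2.1) (X.l2_S1 v hv2)
      rcases List.mem_cons.1 h with h | h
      · exact absurd h (X.l2_hub X.isHub_D v hv2)
      · exact X.l2_S2 X.isHub_D v hv2 h
  have gH : GPath (film k) (X.leg₁ ++ X.S1.tail) E₁ X.d := X.hl1.trans X.gS1 fun v hvS hv1 => X.l1_S1 v hv1 hvS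
  exact gH.trans gT fun v hvT hvH => by
    rcases List.mem_append.1 hvT with hvT | hvT
    · rcases List.mem_cons.1 hvT with h | h
      · exact h
      rcases List.mem_cons.1 h with h | h
      · rcases List.mem_append.1 hvH with h' | h'
        · exact absurd h (X.l1_hub X.isHub_D _ h')
        · exact absurd (List.mem_of_mem_tail h') (h ▸ X.hub_S1 X.isHub_D)
      · rcases List.mem_append.1 hvH with h' | h'
        · exact absurd h (X.l1_S2 X.isHub_D v h')
        · exact absurd h (X.S1_S2 X.isHub_D v (List.mem_of_mem_tail h'))
    · have hv2 : v ∈ X.leg₂ := List.mem_of_mem_tail hvT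
      rcases List.mem_append.1 hvH with h' | h'
      · exact absurd hv2 (X.l12 v h')
      · exact absurd (List.mem_of_mem_tail h') (X.l2_S1 v hv2)

/-- `SP1` decomposed. [folklore] -/
theorem SP1_eq : X.SP1 = X.leg₁.dropLast ++ X.S1 ++ (X.HD :: X.S2 X.LD ++ X.leg₂.tail) := by
  rw [SP1, X.hl1.eq_dropLast_concat]
  have hs : X.S1 = X.e₁ :: X.S1.tail := X.gS1.eq_cons
  conv_rhs => rw [hs]
  simp [HubDataX.e₁]

/-- Membership in `SP1`. [folklore] -/
theorem mem_SP1 {v : slab111 k} (hv : v ∈ X.SP1) : v ∈ X.leg₁ ∨ v ∈ X.S1 ∨ v = X.HD ∨ v ∈ X.S2 X.LD ∨ v ∈ X.leg₂ := by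
  rw [SP1_eq] at hv
  rcases List.mem_append.1 hv with hv | hv
  · rcases List.mem_append.1 hv with h | h
    · exact Or.inl (List.mem_of_mem_dropLast h)
    · exact Or.inr (Or.inl h)
  · rcases List.mem_cons.1 hv with h | h
    · exact Or.inr (Or.inr (Or.inl h))
    rcases List.mem_append.1 h with h | h
    · exact Or.inr (Or.inr (Or.inr (Or.inl h)))
    · exact Or.inr (Or.inr (Or.inr (Or.inr (List.mem_of_mem_tail h))))

/-- The interior of `SP1` lies in `PR`. [folklore] -/
theorem SP1_PR : ∀ x ∈ X.SP1.tail.dropLast, x ∈ PR := by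
  intro x hx
  obtain ⟨hxm, hxE1, hxE2⟩ := X.gSP1.mem_interior hx
  rcases X.mem_SP1 hxm with h | h | h | h | h
  · exact X.l1_PR x h hxE1
  · exact X.S1_PR x h
  · exact h ▸ X.hHD
  · exact (X.S2_facts X.isHub_D).2.1 x h
  · exact X.l2_PR x h hxE2

/-- `c, y` are consecutive on `SP1`. [folklore] -/
theorem SP1_cy : ∃ l₁ l₂ : List (slab111 k), X.SP1 = l₁ ++ X.c :: X.y :: l₂ := by
  obtain ⟨sl₁, sl₂, h⟩ := X.S1_split
  exact ⟨X.leg₁.dropLast ++ sl₁, sl₂ ++ (X.HD :: X.S2 X.LD ++ X.leg₂.tail), by rw [SP1_eq, h]; simp⟩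

/-- `Br1` is a self-avoiding path `H_A → w'`. [folklore] -/
theorem gBr1 : GPath (film k) X.Br1 X.HA w' := by
  have g : GPath (film k) (X.S3 X.LA ++ X.leg₃.tail) (rideV k z c0 X.F3 (X.LA + X.d₃)) w' :=
    (X.S3_facts X.isHub_A).1.trans X.hl3 fun v hv3 hvS => X.l3_S3 X.isHub_A v hv3 hvS
  refine g.cons (X.adj_hub3 X.isHub_A) ?_
  intro h
  rcases List.mem_append.1 h with h | h
  · exact (X.S3_facts X.isHub_A).2.2.2.1 X.isHub_A h
  · exact X.l3_hub X.isHub_A _ (List.mem_of_mem_tail h) rfl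

/-- `Br1 ⊆ W`. [folklore] -/
theorem Br1_W : ∀ x ∈ X.Br1, x ∈ W := by
  intro x hx
  rcases List.mem_cons.1 hx with h | h
  · exact h ▸ X.hPRW X.hHA
  rcases List.mem_append.1 h with h | h
  · exact (X.S3_facts X.isHub_A).2.1 x h
  · exact X.l3_W x (List.mem_of_mem_tail h)

/-- `Br1` is off `SP1`. [folklore] -/
theorem Br1_off : ∀ x ∈ X.Br1, x ∉ X.SP1 := by
  intro x hx hxP
  have hx' : x = X.HA ∨ x ∈ X.S3 X.LA ∨ x ∈ X.leg₃ := by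
    rcases List.mem_cons.1 hx with h | h
    · exact Or.inl h
    rcases List.mem_append.1 h with h | h
    · exact Or.inr (Or.inl h)
    · exact Or.inr (Or.inr (List.mem_of_mem_tail h))
  rcases X.mem_SP1 hxP with hP | hP | hP | hP | hP
  · -- x ∈ leg₁
    rcases hx' with h | h | h
    · exact X.l1_hub X.isHub_A x hP h
    · exact X.l1_S3 X.isHub_A x hP h
    · exact X.l13 x hP h
  · -- x ∈ S1
    rcases hx' with h | h | h
    · exact X.hub_S1 X.isHub_A (by change X.HA ∈ X.S1; rw [← h]; exact hP)
    · exact X.S1_S3 X.isHub_A x hP h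
    · exact X.l3_S1 x h hP
  · -- x = HD
    rcases hx' with h | h | h
    · exact X.HA_ne_HD (h ▸ hP.symm).symm
    · exact (X.S3_facts X.isHub_A).2.2.2.1 X.isHub_D (by change X.HD ∈ X.S3 X.LA; rw [← hP]; exact h)
    · exact X.l3_hub X.isHub_D x h hP
  · -- x ∈ S2 LD
    rcases hx' with h | h | h
    · exact (X.S2_facts X.isHub_D).2.2.2.1 X.isHub_A (by change X.HA ∈ X.S2 X.LD; rw [← h]; exact hP)
    · exact X.S2_S3 X.isHub_D X.isHub_A x hP h
    · exact X.l3_S2 X.isHub_D x h hP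
  · -- x ∈ leg₂
    rcases hx' with h | h | h
    · exact X.l2_hub X.isHub_A x hP h
    · exact X.l2_S3 X.isHub_A x hP h
    · exact X.l23 x hP h

/-- **ROUTING 1** of the hub construction: attachment vertex `c`, successor `y`, branch head `H_A`.
[cite: DuminilCopinSidoraviciusTassion2016, §2.3 (proof of Fact 2: γ_u, γ_v, γ_w)] -/
def route₁ : VRouteData (film k) PR W E₁ E₂ w' :=
  VRouteData.ofPaths X.gSP1 X.hne X.SP1_PR X.SP1_cy X.gBr1 X.Br1_W X.adj_HA_c.symm X.Br1_off

/-- The successor of routing 1 is `y`. [folklore] -/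
@[simp] theorem route₁_y : X.route₁.y = X.y := VRouteData.ofPaths_y _ _ _ _ _ _ _ _

/-- The branch head of routing 1 is `H_A`. [folklore] -/
@[simp] theorem route₁_b : X.route₁.b = X.HA := VRouteData.ofPaths_b _ _ _ _ _ _ _ _

end HubDataX

end Slab111

end Summit.CriticalPhenomena.PercolationContinuityZ3.Theorems.Transplant

end
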